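import Mathlib
import Literature.NumberTheory.Transcendental.MZVWordShuffle
import HarnessLib
import HarnessLib.Audit

/-!
# SoloInformed — the shuffle of two words as a sum over colourings (PROGRAMME XLII, file 1)

Solo programme `solo-KontsevichZagierPeriods-informed`, session s47.

Combinatorial half of the all-depth shuffle product in the formal period ring `𝒫`: the list
`MZV.shuffleWord u v` of interleavings of two binary words is re-indexed by COLOURINGS
`c : Fin n → Bool` (`n = |u| + |v|`) with exactly `|u|` positions coloured `true`. The interleaving
attached to `c` carries at position `k` the next unread letter of `u` if `c k = true` and the next
unread letter of `v` otherwise (`soloInformedFillC`). Main result (`soloInformed_shuffleWord_sum`):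
for every function `F` into an additive commutative monoid,

  `((u ш v).map F).sum = ∑_{c : Fin n → Bool, #c⁻¹(true) = |u|} F (fill_c(u, v))`.

This is the dictionary between the word side (`MZV.shuffleWord`, Literature) and the geometric side
(linear extensions of the union of two chains, file 2): it is used in file 3 to prove
`mzvClass s * mzvClass t = ∑_{W ∈ bw(s) ш bw(t)} mzvClass (ofBinaryWord W)` in `𝒫` by naive moves.
The end-letter lemmas `soloInformed_fillC_zero` / `soloInformed_fillC_last` record that every
interleaving of two admissible words begins with `0` and ends with `1`.

References: Reutenauer 1993, *Free Lie algebras*, §1.4 (shuffles ↔ subsets of positions);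
Eie 2013 §1.2; Ihara–Kaneko–Zagier 2006 §1; Kontsevich–Zagier 2001 §1.2 [KontsevichZagier2001].
-/

open Literature.NumberTheory.Transcendental

namespace Summit.KontsevichZagierPeriods.KontsevichZagierPeriods.Theorems

variable {n : ℕ}

/-! ## 1. Colourings and the interleaving they define -/

/-- Number of `true`-coloured positions strictly before `k`. -/
def soloInformedIdxC (c : Fin n → Bool) (k : Fin n) : ℕ :=
  (Finset.univ.filter fun j : Fin n => j < k ∧ c j = true).card

/-- Number of `true`-coloured positions. -/
def soloInformedCountC (c : Fin n → Bool) : ℕ :=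
  (Finset.univ.filter fun j : Fin n => c j = true).card

/-- The interleaving of `u` and `v` attached to the colouring `c`: position `k` carries the
`(#true before k)`-th letter of `u` if `c k = true`, else the `(#false before k)`-th letter of `v`
(letters beyond the end of a word default to `false`). -/
def soloInformedFillC (c : Fin n → Bool) (u v : List Bool) (k : Fin n) : Bool :=
  if c k = true then u.getD (soloInformedIdxC c k) false
  else v.getD (soloInformedIdxC (fun j => !c j) k) false

/-- No position precedes position `0`. -/
theorem soloInformed_idxC_zero (c : Fin (n + 1) → Bool) : soloInformedIdxC c 0 = 0 := by
  unfold soloInformedIdxC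
  rw [Finset.card_eq_zero, Finset.filter_eq_empty_iff]
  rintro j - ⟨hj, -⟩
  exact Fin.not_lt_zero j hj

/-- Under the all-`true` colouring the `u`-index of position `k` is `k`. -/
theorem soloInformed_idxC_const_true (k : Fin n) :
    soloInformedIdxC (fun _ : Fin n => true) k = k := by
  unfold soloInformedIdxC
  have h : (Finset.univ.filter fun j : Fin n => j < k ∧ true = true) = Finset.Iio k := by
    ext j
    simp
  rw [h, Fin.card_Iio]

/-- `cons` recursion for the `u`-index: a new first position shifts the index by its colour. -/
theorem soloInformed_idxC_cons_succ (x : Bool) (c : Fin n → Bool) (k : Fin n) :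
    soloInformedIdxC (Fin.cons x c : Fin (n + 1) → Bool) k.succ =
      soloInformedIdxC c k + (if x = true then 1 else 0) := by
  unfold soloInformedIdxC
  rw [Finset.card_filter, Finset.card_filter, Fin.sum_univ_succ, add_comm]
  congr 1
  · refine Finset.sum_congr rfl fun j _ => ?_
    simp only [Fin.succ_lt_succ_iff, Fin.cons_succ]
  · simp only [Fin.succ_pos, Fin.cons_zero, true_and]

/-- `cons` recursion for the number of `true` positions. -/
theorem soloInformed_countC_cons (x : Bool) (c : Fin n → Bool) :
    soloInformedCountC (Fin.cons x c : Fin (n + 1) → Bool) =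
      soloInformedCountC c + (if x = true then 1 else 0) := by
  unfold soloInformedCountC
  rw [Finset.card_filter, Finset.card_filter, Fin.sum_univ_succ, add_comm]
  simp only [Fin.cons_zero, Fin.cons_succ]

/-- The complementary colouring of a `cons`-colouring. -/
theorem soloInformed_not_cons (x : Bool) (c : Fin n → Bool) :
    (fun j => !(Fin.cons x c : Fin (n + 1) → Bool) j) = Fin.cons (!x) (fun j => !c j) := by
  funext j
  refine Fin.cases ?_ (fun i => ?_) j
  · simp only [Fin.cons_zero]
  · simp only [Fin.cons_succ]

/-- The numbers of `true` and of `false` positions add up to `n`. -/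
theorem soloInformed_countC_add_countC_not (c : Fin n → Bool) :
    soloInformedCountC c + soloInformedCountC (fun j => !c j) = n := by
  unfold soloInformedCountC
  have h : (Finset.univ.filter fun j : Fin n => (!c j) = true) =
      Finset.univ.filter fun j : Fin n => ¬ c j = true := by
    ext j
    simp
  rw [h, Finset.card_filter_add_card_filter_not, Finset.card_univ, Fintype.card_fin]

/-- At the last position the `u`-index and the colour of that position make up the full count. -/
theorem soloInformed_idxC_last (c : Fin (n + 1) → Bool) :
    soloInformedIdxC c (Fin.last n) + (if c (Fin.last n) = true then 1 else 0) =
      soloInformedCountC c := by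
  unfold soloInformedIdxC soloInformedCountC
  rw [Finset.card_filter, Finset.card_filter, Fin.sum_univ_castSucc, Fin.sum_univ_castSucc]
  simp only [Fin.castSucc_lt_last, true_and, lt_self_iff_false, false_and, if_false, add_zero]

/-- A first position coloured `true` reads the first letter of `u`. -/
theorem soloInformed_fillC_cons_true (c : Fin n → Bool) (a : Bool) (u v : List Bool) :
    soloInformedFillC (Fin.cons true c : Fin (n + 1) → Bool) (a :: u) v =
      Fin.cons a (soloInformedFillC c u v) := by
  funext k
  refine Fin.cases ?_ (fun i => ?_) k
  · unfold soloInformedFillC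
    simp only [Fin.cons_zero, soloInformed_idxC_zero, List.getD_cons_zero, if_true]
  · unfold soloInformedFillC
    rw [soloInformed_not_cons, soloInformed_idxC_cons_succ, soloInformed_idxC_cons_succ]
    simp only [Fin.cons_succ, if_true, Bool.not_true, Bool.false_eq_true, if_false, add_zero,
      List.getD_cons_succ]

/-- A first position coloured `false` reads the first letter of `v`. -/
theorem soloInformed_fillC_cons_false (c : Fin n → Bool) (b : Bool) (u v : List Bool) :
    soloInformedFillC (Fin.cons false c : Fin (n + 1) → Bool) u (b :: v) =
      Fin.cons b (soloInformedFillC c u v) := by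
  funext k
  refine Fin.cases ?_ (fun i => ?_) k
  · unfold soloInformedFillC
    rw [soloInformed_not_cons]
    simp only [Fin.cons_zero, soloInformed_idxC_zero, List.getD_cons_zero, Bool.false_eq_true,
      if_false]
  · unfold soloInformedFillC
    rw [soloInformed_not_cons, soloInformed_idxC_cons_succ, soloInformed_idxC_cons_succ]
    simp only [Fin.cons_succ, if_true, Bool.not_false, Bool.false_eq_true, if_false, add_zero,
      List.getD_cons_succ]

/-! ## 2. Reading lists as functions and back -/

/-- Reading a list of the right length back from its letter function. -/
theorem soloInformed_ofFn_getD (v : List Bool) (h : v.length = n) :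
    List.ofFn (fun k : Fin n => v.getD k false) = v := by
  subst h
  apply List.ext_getElem
  · simp
  · intro i h1 h2
    rw [List.getElem_ofFn, List.getD_eq_getElem _ _ h2]

/-- Splitting a sum over colourings of `n + 1` positions by the colour of position `0`. -/
theorem soloInformed_sum_colouring_succ {M : Type*} [AddCommMonoid M]
    (G : (Fin (n + 1) → Bool) → M) :
    ∑ c : Fin (n + 1) → Bool, G c =
      ∑ c : Fin n → Bool, G (Fin.cons true c) + ∑ c : Fin n → Bool, G (Fin.cons false c) := by
  rw [← (Fin.consEquiv fun _ => Bool).sum_comp, Fintype.sum_prod_type, Fintype.sum_bool]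
  rfl

/-! ## 3. The shuffle of two words as a sum over colourings -/

/-- **LEMMA SW.** The sum of `F` over the shuffle `u ш v` equals the sum over the colourings
`c : Fin n → Bool` (`n = |u| + |v|`) with `|u|` positions coloured `true` of `F` of the interleaving
defined by `c`. (Reutenauer 1993 §1.4: shuffles of `u` and `v` ↔ `|u|`-subsets of positions.) -/
theorem soloInformed_shuffleWord_sum {M : Type*} [AddCommMonoid M] :
    ∀ (u v : List Bool) (n : ℕ) (F : List Bool → M), u.length + v.length = n →
      ((MZV.shuffleWord u v).map F).sum =
        ∑ c : Fin n → Bool,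
          if soloInformedCountC c = u.length then F (List.ofFn (soloInformedFillC c u v)) else 0 := by
  intro u
  induction u with
  | nil =>
    intro v n F h
    rw [List.length_nil, zero_add] at h
    rw [MZV.shuffleWord_nil_left, List.map_singleton, List.sum_singleton,
      Finset.sum_eq_single (fun _ : Fin n => false)]
    · rw [if_pos (by simp [soloInformedCountC])]
      have hf : soloInformedFillC (fun _ : Fin n => false) [] v = fun k : Fin n => v.getD k false := by
        funext k
        simp [soloInformedFillC, soloInformed_idxC_const_true]
      rw [hf, soloInformed_ofFn_getD v h]
    · intro c _ hc
      rw [if_neg]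
      intro hcnt
      apply hc
      funext j
      unfold soloInformedCountC at hcnt
      rw [List.length_nil, Finset.card_eq_zero, Finset.filter_eq_empty_iff] at hcnt
      simpa using hcnt (Finset.mem_univ j)
    · simp
  | cons a u ihu =>
    intro v
    induction v with
    | nil =>
      intro n F h
      have hn : (a :: u).length = n := by simpa using h
      rw [MZV.shuffleWord_nil_right, List.map_singleton, List.sum_singleton,
        Finset.sum_eq_single (fun _ : Fin n => true)]
      · rw [if_pos (by simp [soloInformedCountC, hn])]
        have hf : soloInformedFillC (fun _ : Fin n => true) (a :: u) [] =
            fun k : Fin n => (a :: u).getD k false := by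
          funext k
          simp [soloInformedFillC, soloInformed_idxC_const_true]
        rw [hf, soloInformed_ofFn_getD (a :: u) hn]
      · intro c _ hc
        rw [if_neg]
        intro hcnt
        apply hc
        funext j
        unfold soloInformedCountC at hcnt
        have huniv := Finset.eq_univ_of_card _ (by rw [hcnt, hn, Fintype.card_fin] :
          (Finset.univ.filter fun j : Fin n => c j = true).card = Fintype.card (Fin n))
        have hj := Finset.mem_univ j
        rw [← huniv, Finset.mem_filter] at hj
        exact hj.2
      · simp
    | cons b v ihv =>
      intro n F h
      obtain ⟨m, rfl⟩ : ∃ m, n = m + 1 := ⟨u.length + (v.length + 1), by simp at h; omega⟩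
      have h1 : u.length + (b :: v).length = m := by simp at h ⊢; omega
      have h2 : (a :: u).length + v.length = m := by simp at h ⊢; omega
      rw [MZV.shuffleWord_cons_cons, List.map_append, List.sum_append, List.map_map, List.map_map,
        ihu (b :: v) m (F ∘ List.cons a) h1, ihv m (F ∘ List.cons b) h2,
        soloInformed_sum_colouring_succ]
      congr 1
      · refine Finset.sum_congr rfl fun c _ => ?_
        rw [soloInformed_countC_cons, soloInformed_fillC_cons_true, List.ofFn_succ]
        simp only [if_true, List.length_cons, Nat.add_right_cancel_iff, Function.comp_apply,
          Fin.cons_zero, Fin.cons_succ]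
      · refine Finset.sum_congr rfl fun c _ => ?_
        rw [soloInformed_countC_cons, soloInformed_fillC_cons_false, List.ofFn_succ]
        simp only [Bool.false_eq_true, if_false, add_zero, List.length_cons, Function.comp_apply,
          Fin.cons_zero, Fin.cons_succ]

/-! ## 4. End letters of an interleaving -/

/-- If both words begin with the letter `0` (or are empty), so does every interleaving. -/
theorem soloInformed_fillC_zero (c : Fin (n + 1) → Bool) (u v : List Bool)
    (hu : u.getD 0 false = false) (hv : v.getD 0 false = false) :
    soloInformedFillC c u v 0 = false := by
  unfold soloInformedFillC
  rw [soloInformed_idxC_zero, soloInformed_idxC_zero, hu, hv]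
  split_ifs <;> rfl

/-- If both words end with the letter `1` and the colouring has `|u|` positions `true` (so
`|v|` positions `false`), the interleaving ends with `1`. -/
theorem soloInformed_fillC_last (c : Fin (n + 1) → Bool) (u v : List Bool)
    (hc : soloInformedCountC c = u.length) (h : u.length + v.length = n + 1)
    (hu : u.getLast? = some true) (hv : v.getLast? = some true) :
    soloInformedFillC c u v (Fin.last n) = true := by
  have key := soloInformed_idxC_last c
  have keyn := soloInformed_idxC_last (fun j => !c j)
  have hcn := soloInformed_countC_add_countC_not c
  unfold soloInformedFillC
  cases hlast : c (Fin.last n)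
  · simp only [hlast, Bool.false_eq_true, if_false, Bool.not_false, if_true] at keyn ⊢
    have hi : soloInformedIdxC (fun j => !c j) (Fin.last n) = v.length - 1 := by omega
    rw [hi, List.getD_eq_getElem?_getD, ← List.getLast?_eq_getElem?, hv]
    rfl
  · simp only [hlast, if_true] at key ⊢
    have hi : soloInformedIdxC c (Fin.last n) = u.length - 1 := by omega
    rw [hi, List.getD_eq_getElem?_getD, ← List.getLast?_eq_getElem?, hu]
    rfl

/-- Hence the word `List.ofFn (fill_c(u, v))` begins with `0` … -/
theorem soloInformed_ofFn_fillC_head? (c : Fin (n + 1) → Bool) (u v : List Bool)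
    (hu : u.getD 0 false = false) (hv : v.getD 0 false = false) :
    (List.ofFn (soloInformedFillC c u v)).head? = some false := by
  rw [List.ofFn_succ, List.head?_cons, soloInformed_fillC_zero c u v hu hv]

/-- … and ends with `1`. -/
theorem soloInformed_ofFn_fillC_getLast? (c : Fin (n + 1) → Bool) (u v : List Bool)
    (hc : soloInformedCountC c = u.length) (h : u.length + v.length = n + 1)
    (hu : u.getLast? = some true) (hv : v.getLast? = some true) :
    (List.ofFn (soloInformedFillC c u v)).getLast? = some true := by
  rw [List.ofFn_succ', List.concat_eq_append, List.getLast?_concat,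
    soloInformed_fillC_last c u v hc h hu hv]

end Summit.KontsevichZagierPeriods.KontsevichZagierPeriods.Theorems
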